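import Summits.Ventures.PercRepro.Night2TwoOneColumn

/-!
# PercRepro — the cell `(2, 1)` with two fat closures: the thin faces at plane points (night-2, gen 28)

Spread regime of the two-fat-closure clause (`Night2TwoOneColumn`).  A thin face `S ∖ w` at a plane point `w` is not
fat (its closure misses `w ∈ H₀ ∩ H₁`), so it requests at most `7/54` (`req_le_of_plane_face`); it leaves a plane part
`(S ∩ P) ∖ w` of rank `≤ 2` when `S` meets both classes (`rkN_plane_erase_le_two_of_thin_face`), hence there is at
most ONE such face when the plane part has rank `≥ 3` and `≥ 4` points (`plane_face_unique`), and the layer-1 request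
of such a set is at most `7/24 · (number of thin faces at class points) + 7/54` (`L1_le_of_spanning`).
-/

namespace PercRepro.Shadow

open Finset PerFlat ThmH

variable {α : Type*} [DecidableEq α] {M : Matroid α} [M.Finite]

section Faces

variable {G : Finset α}

/-- A thin face at a plane point is not fat: its request is at most `7/54`. -/
theorem req_le_of_plane_face (hG : G ∈ flatsQ M (5 + 1)) (hd : (gr M \ G).card = 2)
    {B₀ B₁ : Finset α} (hB₀ : B₀ ∈ thinMembers M 5 G) (hB₁ : B₁ ∈ thinMembers M 5 G)
    (hm₀ : (G \ clF M B₀).card ≤ 2) (hm₁ : (G \ clF M B₁).card ≤ 2) (hne : clF M B₀ ≠ clF M B₁)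
    (hfat : (fatClosures M 5 G 2).card ≤ 2)
    (hsp : ∀ B ∈ thinMembers M 5 G, 2 < (G \ clF M B).card → 7 ≤ (G \ clF M B).card)
    {F : Finset α} (hF : F ∈ thinMembers M 5 G) {w : α} (hw : w ∈ clF M B₀ ∩ clF M B₁) (hwF : w ∉ clF M F) :
    req M 5 F ≤ 7 / 54 := by
  rcases req_cases_of_thin_sp hG hd hsp hF with h | h
  · exfalso
    rcases clF_eq_or_eq_of_fat hB₀ hB₁ hm₀ hm₁ hne hfat hF h.1.le with h' | h'
    · exact hwF (h' ▸ (Finset.mem_inter.1 hw).1)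
    · exact hwF (h' ▸ (Finset.mem_inter.1 hw).2)
  · exact h.2

/-- A thin face at a plane point `w` leaves a plane part `(S ∩ P) ∖ w` of rank `≤ 2` (points of both classes in `S`). -/
theorem rkN_plane_erase_le_two_of_thin_face (hG : G ∈ flatsQ M (5 + 1)) (hd : (gr M \ G).card = 2)
    (hk : kColoops M G = 1) {B₀ B₁ : Finset α} (hB₀ : B₀ ∈ thinMembers M 5 G) (hB₁ : B₁ ∈ thinMembers M 5 G)
    (hdisj : Disjoint (G \ clF M B₀) (G \ clF M B₁)) {S : Finset α}
    {u u' : α} (hu : u ∈ S ∩ (G \ clF M B₀)) (hu' : u' ∈ S ∩ (G \ clF M B₁))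
    {w : α} (hw : w ∈ S ∩ ((clF M B₀ ∩ clF M B₁) \ coloops M G)) (hthin : S.erase w ∈ thinMembers M 5 G) :
    rkN M ((S ∩ ((clF M B₀ ∩ clF M B₁) \ coloops M G)).erase w) ≤ 2 := by
  have hd' : (gr M \ G).card ≤ 5 := by omega
  have hKH₀ : coloops M G ⊆ clF M B₀ := (coloops_subset_of_mem_thinMembers hG hd' hB₀).trans
    (subset_clF (mem_membersIn.1 (mem_thinMembers.1 hB₀).1).1)
  have hKH₁ : coloops M G ⊆ clF M B₁ := (coloops_subset_of_mem_thinMembers hG hd' hB₁).trans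
    (subset_clF (mem_membersIn.1 (mem_thinMembers.1 hB₁).1).1)
  have h4 := rkN_sdiff_coloops_eq_four_of_thin hG hd hk hthin
  have hX : (S ∩ ((clF M B₀ ∩ clF M B₁) \ coloops M G)).erase w ⊆ clF M B₀ ∩ clF M B₁ :=
    (Finset.erase_subset _ _).trans (Finset.inter_subset_right.trans Finset.sdiff_subset)
  have h2 := rkN_add_two_le_of_classes hG hdisj hX (Finset.mem_inter.1 hu).2 (Finset.mem_inter.1 hu').2
  have hwP := (Finset.mem_sdiff.1 (Finset.mem_inter.1 hw).2)
  have hsub : insert u (insert u' ((S ∩ ((clF M B₀ ∩ clF M B₁) \ coloops M G)).erase w)) ⊆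
      S.erase w \ coloops M G := by
    intro y hy
    rw [Finset.mem_insert, Finset.mem_insert] at hy
    rw [Finset.mem_sdiff, Finset.mem_erase]
    rcases hy with rfl | rfl | hy
    · refine ⟨⟨fun h => ?_, (Finset.mem_inter.1 hu).1⟩, fun h => (Finset.mem_sdiff.1 (Finset.mem_inter.1 hu).2).2 (hKH₀ h)⟩
      rw [h] at hu
      exact (Finset.mem_sdiff.1 (Finset.mem_inter.1 hu).2).2 (Finset.mem_inter.1 hwP.1).1
    · refine ⟨⟨fun h => ?_, (Finset.mem_inter.1 hu').1⟩, fun h => (Finset.mem_sdiff.1 (Finset.mem_inter.1 hu').2).2 (hKH₁ h)⟩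
      rw [h] at hu'
      exact (Finset.mem_sdiff.1 (Finset.mem_inter.1 hu').2).2 (Finset.mem_inter.1 hwP.1).2
    · rw [Finset.mem_erase, Finset.mem_inter, Finset.mem_sdiff] at hy
      exact ⟨⟨hy.1, hy.2.1⟩, hy.2.2.2⟩
  have := rkN_mono (M := M) hsub
  omega

/-- **At most one thin face at a plane point** when the plane part has rank `≥ 3` and `≥ 4` points. -/
theorem plane_face_unique (hG : G ∈ flatsQ M (5 + 1)) (hd : (gr M \ G).card = 2)
    (hk : kColoops M G = 1) (hs : ∀ e ∈ gr M, ∀ f ∈ gr M, e ≠ f → rkN M {e, f} = 2)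
    {B₀ B₁ : Finset α} (hB₀ : B₀ ∈ thinMembers M 5 G) (hB₁ : B₁ ∈ thinMembers M 5 G)
    (hdisj : Disjoint (G \ clF M B₀) (G \ clF M B₁)) {S : Finset α} (hSG : S ⊆ G)
    (hSP3 : 3 ≤ rkN M (S ∩ ((clF M B₀ ∩ clF M B₁) \ coloops M G)))
    (hSP4 : 4 ≤ (S ∩ ((clF M B₀ ∩ clF M B₁) \ coloops M G)).card)
    {u u' : α} (hu : u ∈ S ∩ (G \ clF M B₀)) (hu' : u' ∈ S ∩ (G \ clF M B₁))
    {w₁ w₂ : α} (hw₁ : w₁ ∈ S ∩ ((clF M B₀ ∩ clF M B₁) \ coloops M G))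
    (hw₂ : w₂ ∈ S ∩ ((clF M B₀ ∩ clF M B₁) \ coloops M G)) (hthin₁ : S.erase w₁ ∈ thinMembers M 5 G)
    (hthin₂ : S.erase w₂ ∈ thinMembers M 5 G) : w₁ = w₂ := by
  have hGg : G ⊆ gr M := (mem_flatsQ.1 hG).1
  by_contra hne12
  have hr₁ := rkN_plane_erase_le_two_of_thin_face hG hd hk hB₀ hB₁ hdisj hu hu' hw₁ hthin₁
  have hr₂ := rkN_plane_erase_le_two_of_thin_face hG hd hk hB₀ hB₁ hdisj hu hu' hw₂ hthin₂
  set SP := S ∩ ((clF M B₀ ∩ clF M B₁) \ coloops M G) with hSP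
  have hSPg : SP ⊆ gr M := Finset.inter_subset_left.trans (hSG.trans hGg)
  have hinter : (SP.erase w₁) ∩ (SP.erase w₂) = (SP.erase w₁).erase w₂ := by
    ext x
    simp only [Finset.mem_inter, Finset.mem_erase]
    tauto
  have hcard : 2 ≤ ((SP.erase w₁) ∩ (SP.erase w₂)).card := by
    rw [hinter]
    have h1 := Finset.pred_card_le_card_erase (s := SP) (a := w₁)
    have h2 := Finset.pred_card_le_card_erase (s := SP.erase w₁) (a := w₂)
    omega
  have hsub₁ := subset_clF_inter_of_rkN_le_two hs ((Finset.erase_subset _ _).trans hSPg) hr₁ hcard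
  have hcard' : 2 ≤ ((SP.erase w₂) ∩ (SP.erase w₁)).card := by rw [Finset.inter_comm]; exact hcard
  have hsub₂ := subset_clF_inter_of_rkN_le_two hs ((Finset.erase_subset _ _).trans hSPg) hr₂ hcard'
  rw [Finset.inter_comm] at hsub₂
  have hSPsub : SP ⊆ clF M ((SP.erase w₁) ∩ (SP.erase w₂)) := by
    intro x hx
    by_cases hx1 : x = w₁
    · exact hsub₂ (Finset.mem_erase.2 ⟨hx1 ▸ hne12, hx⟩)
    · exact hsub₁ (Finset.mem_erase.2 ⟨hx1, hx⟩)
  have h1 := rkN_mono (M := M) hSPsub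
  rw [rkN_clF] at h1
  have h2 := rkN_mono (M := M) (Finset.inter_subset_left : (SP.erase w₁) ∩ (SP.erase w₂) ⊆ SP.erase w₁)
  omega

open scoped Classical in
/-- **THE LAYER-1 REQUEST OF A SET MEETING BOTH CLASSES WHOSE PLANE PART SPANS `P` WITH `≥ 4` POINTS**: at most
`7/24` per thin face at a class point and at most `7/54` for the (unique) thin face at a plane point. -/
theorem L1_le_of_spanning (hG : G ∈ flatsQ M (5 + 1)) (hd : (gr M \ G).card = 2) (hk : kColoops M G = 1)
    (hs : ∀ e ∈ gr M, ∀ f ∈ gr M, e ≠ f → rkN M {e, f} = 2) {B₀ B₁ : Finset α}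
    (hB₀ : B₀ ∈ thinMembers M 5 G) (hB₁ : B₁ ∈ thinMembers M 5 G) (hm₀ : (G \ clF M B₀).card ≤ 2)
    (hm₁ : (G \ clF M B₁).card ≤ 2) (hne : clF M B₀ ≠ clF M B₁) (hfat : (fatClosures M 5 G 2).card ≤ 2)
    (hsp : ∀ B ∈ thinMembers M 5 G, 2 < (G \ clF M B).card → 7 ≤ (G \ clF M B).card)
    (hdisj : Disjoint (G \ clF M B₀) (G \ clF M B₁)) {S : Finset α} (hSG : S ⊆ G)
    (hSP3 : 3 ≤ rkN M (S ∩ ((clF M B₀ ∩ clF M B₁) \ coloops M G)))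
    (hSP4 : 4 ≤ (S ∩ ((clF M B₀ ∩ clF M B₁) \ coloops M G)).card)
    {u u' : α} (hu : u ∈ S ∩ (G \ clF M B₀)) (hu' : u' ∈ S ∩ (G \ clF M B₁)) :
    L1 M 5 G S ≤ (((S ∩ ((G \ clF M B₀) ∪ (G \ clF M B₁))).filter
      (fun w => S.erase w ∈ thinMembers M 5 G)).card : ℚ) * (7 / 24) + 7 / 54 := by
  have hd' : (gr M \ G).card ≤ 5 := by omega
  set Pre := (coverPreimages M (Uq M (5 + 2) 5) G S).filter (fun B => B ∉ lay0 M 5 G) with hPre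
  set W := (S \ coloops M G).filter (fun w => S.erase w ∈ Pre) with hW
  have hthin : ∀ F ∈ Pre, F ∈ thinMembers M 5 G := by
    intro F hF
    rw [hPre, Finset.mem_filter, mem_coverPreimages] at hF
    exact mem_thinMembers.2 ⟨hF.1.1, hF.2⟩
  -- a thin preimage `S ∖ w` has `w ∉ cl (S ∖ w)`
  have hnotcl : ∀ w ∈ S, S.erase w ∈ Pre → w ∉ clF M (S.erase w) := by
    intro w hw hF
    rw [hPre, Finset.mem_filter, mem_coverPreimages] at hF
    obtain ⟨z, hz, hzS⟩ := mem_coverSets.1 hF.1.2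
    have hzS' : z ∈ S := by rw [← hzS]; exact Finset.mem_insert_self _ _
    have hzne : z ∉ S.erase w := notMem_of_notMem_clF (mem_membersIn.1 hF.1.1).1 (Finset.mem_sdiff.1 hz).2
    have hzw : z = w := by
      by_contra h
      exact hzne (Finset.mem_erase.2 ⟨h, hzS'⟩)
    have := (Finset.mem_sdiff.1 hz).2
    rwa [hzw] at this
  have hPreEq : Pre = W.image (fun w => S.erase w) := by
    ext F
    rw [Finset.mem_image]
    constructor
    · intro hF
      have h1 := thin_coverPreimages_subset_image_coloops hG hd' S hF
      obtain ⟨w, hw, rfl⟩ := Finset.mem_image.1 h1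
      exact ⟨w, Finset.mem_filter.2 ⟨(mem_coloops.1 hw).1, hF⟩, rfl⟩
    · rintro ⟨w, hw, rfl⟩
      exact (Finset.mem_filter.1 hw).2
  have hL1 : L1 M 5 G S = ∑ w ∈ W, req M 5 (S.erase w) := by
    unfold L1
    rw [← hPre, hPreEq]
    apply Finset.sum_image
    intro w hw w' hw' heq
    exact Finset.erase_injOn S (Finset.mem_sdiff.1 (Finset.mem_filter.1 hw).1).1
      (Finset.mem_sdiff.1 (Finset.mem_filter.1 hw').1).1 heq
  set Xs := (G \ clF M B₀) ∪ (G \ clF M B₁) with hXs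
  rw [hL1, ← Finset.sum_filter_add_sum_filter_not W (fun w => w ∈ Xs)]
  -- the faces at class points
  have h1 : ∑ w ∈ W.filter (fun w => w ∈ Xs), req M 5 (S.erase w) ≤
      (((S ∩ Xs).filter (fun w => S.erase w ∈ thinMembers M 5 G)).card : ℚ) * (7 / 24) := by
    have hsub : W.filter (fun w => w ∈ Xs) ⊆ (S ∩ Xs).filter (fun w => S.erase w ∈ thinMembers M 5 G) := by
      intro w hw
      rw [Finset.mem_filter, hW, Finset.mem_filter, Finset.mem_sdiff] at hw
      exact Finset.mem_filter.2 ⟨Finset.mem_inter.2 ⟨hw.1.1.1, hw.2⟩, hthin _ hw.1.2⟩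
    calc ∑ w ∈ W.filter (fun w => w ∈ Xs), req M 5 (S.erase w)
        ≤ ∑ _w ∈ W.filter (fun w => w ∈ Xs), (7 / 24 : ℚ) := by
          apply Finset.sum_le_sum
          intro w hw
          exact req_le_of_thin_two_one hG hd (hthin _ (Finset.mem_filter.1 (Finset.mem_filter.1 hw).1).2)
      _ = ((W.filter (fun w => w ∈ Xs)).card : ℚ) * (7 / 24) := by rw [Finset.sum_const, nsmul_eq_mul]
      _ ≤ _ := by
          apply mul_le_mul_of_nonneg_right _ (by norm_num)
          exact_mod_cast Finset.card_le_card hsub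
  -- the faces at plane points: at most one, request `≤ 7/54`
  have hplane : ∀ w ∈ W.filter (fun w => ¬ w ∈ Xs), w ∈ S ∩ ((clF M B₀ ∩ clF M B₁) \ coloops M G) := by
    intro w hw
    rw [Finset.mem_filter, hW, Finset.mem_filter, Finset.mem_sdiff] at hw
    have hwG : w ∈ G := hSG hw.1.1.1
    rw [hXs, Finset.mem_union, Finset.mem_sdiff, Finset.mem_sdiff, not_or, not_and, not_and] at hw
    rw [Finset.mem_inter, Finset.mem_sdiff, Finset.mem_inter]
    exact ⟨hw.1.1.1, ⟨not_not.1 (hw.2.1 hwG), not_not.1 (hw.2.2 hwG)⟩, hw.1.1.2⟩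
  have h2 : ∑ w ∈ W.filter (fun w => ¬ w ∈ Xs), req M 5 (S.erase w) ≤ 7 / 54 := by
    have hcard : (W.filter (fun w => ¬ w ∈ Xs)).card ≤ 1 := by
      apply Finset.card_le_one.2
      intro w₁ hw₁ w₂ hw₂
      exact plane_face_unique hG hd hk hs hB₀ hB₁ hdisj hSG hSP3 hSP4 hu hu' (hplane w₁ hw₁) (hplane w₂ hw₂)
        (hthin _ (Finset.mem_filter.1 (Finset.mem_filter.1 hw₁).1).2)
        (hthin _ (Finset.mem_filter.1 (Finset.mem_filter.1 hw₂).1).2)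
    calc ∑ w ∈ W.filter (fun w => ¬ w ∈ Xs), req M 5 (S.erase w)
        ≤ ∑ _w ∈ W.filter (fun w => ¬ w ∈ Xs), (7 / 54 : ℚ) := by
          apply Finset.sum_le_sum
          intro w hw
          have hwS : w ∈ S := (Finset.mem_sdiff.1 (Finset.mem_filter.1 (Finset.mem_filter.1 hw).1).1).1
          have hwP := hplane w hw
          exact req_le_of_plane_face hG hd hB₀ hB₁ hm₀ hm₁ hne hfat hsp
            (hthin _ (Finset.mem_filter.1 (Finset.mem_filter.1 hw).1).2)
            (Finset.mem_sdiff.1 (Finset.mem_inter.1 hwP).2).1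
            (hnotcl w hwS (Finset.mem_filter.1 (Finset.mem_filter.1 hw).1).2)
      _ = ((W.filter (fun w => ¬ w ∈ Xs)).card : ℚ) * (7 / 54) := by rw [Finset.sum_const, nsmul_eq_mul]
      _ ≤ 1 * (7 / 54) := by
          apply mul_le_mul_of_nonneg_right _ (by norm_num)
          exact_mod_cast hcard
      _ = 7 / 54 := by norm_num
  linarith

end Faces

end PercRepro.Shadow
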